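import Summits.ValiantsHypothesis.ValiantsHypothesis.Theorems.MonotoneRestorationOrbitRestorationQPValueOrbitProductTerms
import HarnessLib

/-!
# Worked example: the product of the row sums is orbit-restorable (symmetrisation in ORBIT currency, X)

Route MonotoneRestoration, crux `OrbitRestorationQP` (stmt-ValiantsHypothesis-18293), namespace
`Summit.ValiantsHypothesis.ValiantsHypothesis.Theorems.ValueProducts`.

A usage check of `qpOrbitRestorable_of_affineProductTerms` (`…ValueOrbitProductTerms.lean`) on the simplest
non-sparse, full-degree ΠΣ family: `f_n = Π_i (Σ_j x_ij)` (`n^n` monomials, degree `n`).  The naive computation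
passes through partial products `Π_{i ≤ m} r_i` of orbit `C(n, m)`; the factor multiset `{r_i}_i` is
`Sym(Fin n)`-invariant (orbit `1`) and each row sum has orbit `n`, so the theorem applies with `c = 1`:
`QPOrbitRestorable 6 n f_n` (`rowSumProd_qpOrbitRestorable`).  Everything is proved. [folklore]
-/

noncomputable section

open scoped Classical

-- `Summit.ValiantsHypothesis.ValiantsHypothesis.…` is the tree's single-conjunct layout (Sub = Summit).
set_option linter.dupNamespace false

namespace Summit.ValiantsHypothesis.ValiantsHypothesis.Theorems

namespace ValueProducts

open Finset Literature.Computability.AlgebraicComplexity OrbitRestorationQPDepthThreeRung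

/-- Coefficients of the row sums: `w () i x = [x.1 = i]`. [folklore] -/
def rowW (n : ℕ) : Unit → Fin n → (Fin n × Fin n) → ℂ := fun _ i x => if x.1 = i then 1 else 0

/-- The `i`-th row sum as an affine form (constant `0`). [folklore] -/
theorem affineForm_row (n : ℕ) (i : Fin n) :
    affineForm (fun _ _ => (0 : ℂ)) (rowW n) () i = ∑ j : Fin n, MvPolynomial.X (i, j) := by
  rw [affineForm, map_zero, zero_add, ← Finset.univ_product_univ, Finset.sum_product]
  simp only [rowW]
  rw [Finset.sum_eq_single i]
  · simp
  · intro b _ hb; simp [hb]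
  · intro h; exact absurd (Finset.mem_univ i) h

/-- Renaming a row sum by `σ` gives the row sum of `σ i`. [folklore] -/
theorem ren_rowSum (n : ℕ) (σ : Equiv.Perm (Fin n)) (i : Fin n) :
    ren σ (∑ j : Fin n, MvPolynomial.X (R := ℂ) (i, j)) = ∑ j : Fin n, MvPolynomial.X (σ i, j) := by
  rw [map_sum]
  simp only [ren_X]
  exact Equiv.sum_comp σ (fun j => MvPolynomial.X (R := ℂ) (σ i, j))

/-- **The product of the row sums `Π_i Σ_j x_ij` is `QPOrbitRestorable 6`** at every `n`. [folklore] -/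
theorem rowSumProd_qpOrbitRestorable (n : ℕ) :
    QPOrbitRestorable 6 n (∏ i : Fin n, ∑ j : Fin n, MvPolynomial.X (i, j)) := by
  have hn : n ≤ 2 ^ ((Nat.log 2 n + 1) ^ 1) := by
    rw [pow_one]; exact (Nat.lt_pow_succ_log_self Nat.one_lt_two n).le
  have hrow : ∀ i : Fin n, affineForm (fun _ _ => (0 : ℂ)) (rowW n) () i = ∑ j : Fin n, MvPolynomial.X (i, j) :=
    affineForm_row n
  refine qpOrbitRestorable_of_affineProductTerms (τ := Unit) (ι := Fin n) (c := 1) (fun _ _ => (0 : ℂ)) (rowW n)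
    (fun _ => 1) (fun s i => ?_) (fun s => ?_) (f := ∏ i : Fin n, ∑ j : Fin n, MvPolynomial.X (i, j)) ?_ ?_
  · -- each row sum has orbit `≤ n`
    refine le_trans ?_ hn
    have hsub : (Set.range fun σ : Equiv.Perm (Fin n) => ren σ (affineForm (fun _ _ => (0 : ℂ)) (rowW n) s i)) ⊆
        Set.range fun i' : Fin n => ∑ j : Fin n, MvPolynomial.X (R := ℂ) (i', j) := by
      rintro _ ⟨σ, rfl⟩
      exact ⟨σ i, by simp only [hrow, ren_rowSum]⟩
    refine (Set.ncard_le_ncard hsub (Set.finite_range _)).trans ?_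
    calc (Set.range fun i' : Fin n => ∑ j : Fin n, MvPolynomial.X (R := ℂ) (i', j)).ncard
        ≤ (Set.univ : Set (Fin n)).ncard := by
          rw [← Set.image_univ]; exact Set.ncard_image_le (Set.toFinite _)
      _ = n := by rw [Set.ncard_univ, Nat.card_eq_fintype_card, Fintype.card_fin]
  · -- the multiset of row sums is invariant
    have hinv : ∀ σ : Equiv.Perm (Fin n),
        ((univ : Finset (Fin n)).val.map (affineForm (fun _ _ => (0 : ℂ)) (rowW n) s)).map (ren σ) =
          (univ : Finset (Fin n)).val.map (affineForm (fun _ _ => (0 : ℂ)) (rowW n) s) := by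
      intro σ
      rw [Multiset.map_map]
      have hc : (ren σ) ∘ affineForm (fun _ _ => (0 : ℂ)) (rowW n) s =
          (affineForm (fun _ _ => (0 : ℂ)) (rowW n) s) ∘ σ := by
        funext i
        simp only [Function.comp_apply, hrow, ren_rowSum]
      rw [hc, ← Multiset.map_map, Multiset.map_univ_val_equiv]
    refine le_trans (le_of_eq ?_) Nat.one_le_two_pow
    rw [show (Set.range fun σ : Equiv.Perm (Fin n) =>
        ((univ : Finset (Fin n)).val.map (affineForm (fun _ _ => (0 : ℂ)) (rowW n) s)).map (ren σ)) =
        {(univ : Finset (Fin n)).val.map (affineForm (fun _ _ => (0 : ℂ)) (rowW n) s)} from ?_]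
    · exact Set.ncard_singleton _
    · ext M
      simp only [Set.mem_range, hinv, Set.mem_singleton_iff, exists_const, eq_comm]
  · simp [hrow]
  · intro σ
    rw [map_prod]
    simp only [ren_rowSum]
    exact Equiv.prod_comp σ (fun i => ∑ j : Fin n, MvPolynomial.X (R := ℂ) (i, j))

end ValueProducts

end Summit.ValiantsHypothesis.ValiantsHypothesis.Theorems

end
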